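import Summits.AtomisticToContinuum.HydrodynamicLimit.Theorems.JParityClosureLocalSecondLawContactVelocityMoments
import Summits.AtomisticToContinuum.HydrodynamicLimit.Theorems.JParityClosureLocalSecondLawContactTiltTransfer
import Summits.AtomisticToContinuum.HydrodynamicLimit.Theorems.JParityClosureLocalSecondLawCoarseFieldBounds

/-!
# Stub B′ (`stub_initialMatching`) of the line `contact-asymmetry-information` for the crux `LocalSecondLaw`
(stmt-AtomisticToContinuum-13081) — part 5: the fields half at `s = 0` (momentum and kinetic energy)

`contactB_momKinBar_condLaw_smeared`: under the `t = 0` tie (continuous data and profiles, `σ ≤ 1/2`), for every FIXED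
`r > 0`, `ε > 0` and mass floor `δ″ > 0`, eventually in `N`, for EVERY set `S` with `P_N(S) ≥ δ″` and every centre `x`,
the mean coarse momentum and kinetic energy of the bounded tilt `P_N(·|S)` at `s = 0` match the smeared Euler data:
`‖m̄(0,x) − ∫ b_r ρ(0)u(0)‖ ≤ ε`, `|ē(0,x) − ∫ b_r E(0)| ≤ ε`.  Proof: the flow-free uniform LLN
`contactB_fields_uniformLLN` off a bad event of law-mass `≤ t`, the envelope `H = (3/(πr³))(½ + ke)` with `E[H²] ≤ K`
(`contactB_lintegral_envelope_sq_le`), and the dominated transfer `contactB_norm_integral_sub_le_of_dom` at truncation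
level `L = 4(K+1)/(εδ″)` and `t = εδ″/(4(L + R + 1))`.  Companion of the density statement
`contactB_rhoBar_condLaw_smeared` (`…ContactInitialFields.lean`); together they feed the peculiar-energy term of the
velocity-entropy identity of B′.

References: H. Spohn, *Large Scale Dynamics of Interacting Particles* (1991), Part I §2.3–§3.
-/

noncomputable section

open scoped BigOperators Topology Classical MeasureTheory ENNReal InnerProductSpace
open Filter Set MeasureTheory Function
open Literature.MathematicalPhysics.KineticTheory
open Literature.Analysis.FluidPDE
open Summit.AtomisticToContinuum.HydrodynamicLimit.Theorems.LocalSecondLawNegative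
open Summit.AtomisticToContinuum.HydrodynamicLimit.Theorems.LocalSecondLawLedger

namespace Summit.AtomisticToContinuum.HydrodynamicLimit.Theorems.LocalSecondLawContact

/-- **The fields half of B′ (momentum and kinetic energy): under EVERY bounded tilt the mean coarse momentum and
kinetic energy at `s = 0` match the smeared Euler data.**  Under the `t = 0` tie (continuous data, `σ ≤ 1/2`): for
every fixed `r > 0`, `ε > 0` and mass floor `δ″ > 0`, eventually in `N`, for EVERY `S` with `P_N(S) ≥ δ″` and every
centre `x`, `‖m̄_{P_N(·|S)}(0,x) − ∫ b_r ρ(0)u(0)‖ ≤ ε` and `|ē_{P_N(·|S)}(0,x) − ∫ b_r E(0)| ≤ ε`.  (Uniform LLN off a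
bad event of small mass + the envelope `H = (3/(πr³))(½ + ke)` with `E[H²] ≤ K` uniformly in `N`: the
dominated-observable transfer `contactB_norm_integral_sub_le_of_dom` at truncation level `L = 4(K+1)/(εδ″)`.) -/
theorem contactB_momKinBar_condLaw_smeared :
    ∀ {σ : ℝ} {a₀ θ₀ : T3 → ℝ} {u₀ : T3 → V3} {ρ θ : ℝ → T3 → ℝ} {u : ℝ → T3 → V3},
      Continuous a₀ → Continuous θ₀ → Continuous u₀ → (∀ x, 0 < a₀ x) → (∀ x, 0 < θ₀ x) → σ ≤ 1 / 2 →
      Continuous (ρ 0) → Continuous (u 0) → Continuous (θ 0) →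
      ∀ Φ : (N : ℕ) → Flow σ N, TendstoHydroFieldsAt (fun N => localGibbsLaw σ a₀ u₀ θ₀ N (Φ N)) Φ ρ u θ 0 →
      ∀ {r ε δ'' : ℝ}, 0 < r → 0 < ε → 0 < δ'' → ∃ N₀ : ℕ, ∀ N : ℕ, N₀ ≤ N →
        ∀ S : Set (Phase N), ENNReal.ofReal δ'' ≤ localGibbsLaw σ a₀ u₀ θ₀ N (Φ N) S → ∀ x : T3,
          ‖momBar r (condLaw (localGibbsLaw σ a₀ u₀ θ₀ N (Φ N)) S) (Φ N) 0 x - ∫ y, (cone r y x * ρ 0 y) • u 0 y‖ ≤ ε ∧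
          |kinBar r (condLaw (localGibbsLaw σ a₀ u₀ θ₀ N (Φ N)) S) (Φ N) 0 x -
            ∫ y, cone r y x * totalEnergyDensity (ρ 0 y) (u 0 y) (θ 0 y)| ≤ ε := by
  intro σ a₀ θ₀ u₀ ρ θ u ha hθ hu ha0 hθ0 hσ2 hρc huc hθc Φ h0 r ε δ'' hr hε hδ
  have hEc : Continuous fun x => totalEnergyDensity (ρ 0 x) (u 0 x) (θ 0 x) := by
    unfold totalEnergyDensity; fun_prop
  have hMc : Continuous fun x => ρ 0 x • u 0 x := hρc.smul huc
  obtain ⟨R₂, -, hR₂⟩ := exists_forall_abs_le_of_continuous (continuous_norm.comp hMc)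
  obtain ⟨R₃, hR₃0, hR₃⟩ := exists_forall_abs_le_of_continuous hEc
  have hR2 : ∀ y, ‖ρ 0 y • u 0 y‖ ≤ |R₂| := fun y => by
    have h := hR₂ y
    rw [Function.comp_apply, abs_of_nonneg (norm_nonneg _)] at h
    exact h.trans (le_abs_self _)
  set M : ℝ := 3 / (Real.pi * r ^ 3)
  have hMpos : 0 < M := by positivity
  obtain ⟨K, hK0, HK⟩ := contactB_lintegral_envelope_sq_le a₀ θ₀ u₀ ha hθ hu ha0 hθ0 hr
  -- truncation level and bad-event mass
  set L : ℝ := 4 * (K + 1) / (ε * δ'')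
  have hLpos : 0 < L := by positivity
  have hKL : K / L ≤ ε * δ'' / 4 := by
    rw [div_le_iff₀ hLpos]
    have : ε * δ'' / 4 * L = K + 1 := by
      show ε * δ'' / 4 * (4 * (K + 1) / (ε * δ'')) = K + 1
      field_simp
    nlinarith
  set Rc : ℝ := M * (|R₂| + R₃)
  have hRc : 0 ≤ Rc := by positivity
  set t : ℝ := ε * δ'' / (4 * (L + Rc + 1))
  have htpos : 0 < t := by positivity
  have htL : (L + Rc) * t ≤ ε * δ'' / 4 := by
    have h1 : (L + Rc + 1) * t = ε * δ'' / 4 := by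
      show (L + Rc + 1) * (ε * δ'' / (4 * (L + Rc + 1))) = ε * δ'' / 4
      field_simp
    nlinarith
  obtain ⟨N₀, HN⟩ := contactB_fields_uniformLLN hρc huc hθc Φ h0 hr (half_pos hε) htpos
  refine ⟨N₀, fun N hN S hS x => ?_⟩
  obtain ⟨B, hB, HB⟩ := HN N hN
  set μ : Measure (Phase N) := localGibbsLaw σ a₀ u₀ θ₀ N (Φ N)
  haveI : IsProbabilityMeasure μ := isProbabilityMeasure_localGibbsLaw ha hθ hu ha0 hθ0 hσ2 N (Φ N)
  set B' : Set (Phase N) := toMeasurable μ B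
  have hB' : (μ B').toReal ≤ t := by
    rw [measure_toMeasurable]
    exact ENNReal.toReal_le_of_le_ofReal htpos.le hB
  have hoffB : ∀ z, z ∉ B' → z ∉ B := fun z hz h => hz (subset_toMeasurable μ B h)
  -- the envelope
  set H : Phase N → ℝ := fun z => M * (1 / 2 + ke z)
  have hHm : Measurable H := measurable_const.mul (measurable_const.add contactB_measurable_ke)
  have hHK : ∫⁻ z, ENNReal.ofReal (H z ^ 2) ∂μ ≤ ENNReal.ofReal K := HK σ hσ2 N (Φ N)
  -- common final arithmetic
  have hfin : ∀ {c : ℝ}, 0 ≤ c → c ≤ Rc → ε / 2 + (K / L + (L + c) * (μ B').toReal) / δ'' ≤ ε := by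
    intro c hc hcR
    have h1 : (L + c) * (μ B').toReal ≤ (L + Rc) * t :=
      mul_le_mul (by linarith) hB' ENNReal.toReal_nonneg (by positivity)
    have h2 : K / L + (L + c) * (μ B').toReal ≤ ε * δ'' / 2 := by linarith
    have h3 : (K / L + (L + c) * (μ B').toReal) / δ'' ≤ ε / 2 := by
      rw [div_le_iff₀ hδ]; linarith
    linarith
  refine ⟨?_, ?_⟩
  · -- momentum
    set c : V3 := ∫ y, (cone r y x * ρ 0 y) • u 0 y
    have hc : ‖c‖ ≤ M * |R₂| := by
      have h := contactB_smear_bound_vec hr (fun y => ρ 0 y • u 0 y) hR2 x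
      simp only [← mul_smul] at h
      exact h
    have hcR : ‖c‖ ≤ Rc := hc.trans (by show M * |R₂| ≤ M * (|R₂| + R₃); nlinarith)
    set F : Phase N → V3 := fun z => momC r z x
    have hFm : AEStronglyMeasurable F μ := by
      have hcont : Continuous fun w : Phase N => momC r w x := by
        simpa only [Function.comp_def] using
          (continuous_momC_uncurry (N := N) r).comp (Continuous.prodMk_left x)
      exact hcont.aestronglyMeasurable
    have hFH : ∀ z, ‖F z‖ ≤ H z := fun z => norm_momC_le hr z x
    have hoff : ∀ z, z ∉ B' → ‖F z - c‖ ≤ ε / 2 := fun z hz => (HB z (hoffB z hz) x).2.1.le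
    have key := contactB_norm_integral_sub_le_of_dom μ S B' F H c (ε / 2) K L δ'' (measurableSet_toMeasurable μ B)
      hFm hHm hFH hHK hK0 hLpos (half_pos hε).le hδ hS hoff
    rw [contactB_momBar_zero]
    exact key.trans (hfin (norm_nonneg _) hcR)
  · -- kinetic energy
    set c : ℝ := ∫ y, cone r y x * totalEnergyDensity (ρ 0 y) (u 0 y) (θ 0 y)
    have hc : |c| ≤ M * R₃ := by
      have h := contactB_smear_bound_vec (E := ℝ) hr (fun y => totalEnergyDensity (ρ 0 y) (u 0 y) (θ 0 y))
        (fun y => by rw [Real.norm_eq_abs]; exact hR₃ y) x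
      simp only [smul_eq_mul, Real.norm_eq_abs] at h
      exact h
    have hcR : |c| ≤ Rc := hc.trans (by show M * R₃ ≤ M * (|R₂| + R₃); nlinarith [abs_nonneg R₂])
    set F : Phase N → ℝ := fun z => kinC r z x
    have hFm : AEStronglyMeasurable F μ := by
      have hcont : Continuous fun w : Phase N => kinC r w x := by
        simpa only [Function.comp_def] using
          (continuous_kinC_uncurry (N := N) r).comp (Continuous.prodMk_left x)
      exact hcont.aestronglyMeasurable
    have hFH : ∀ z, ‖F z‖ ≤ H z := fun z => by
      rw [Real.norm_eq_abs, abs_of_nonneg (kinC_nonneg hr z x)]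
      calc kinC r z x ≤ M * ke z := contactB_kinC_le_ke hr z x
        _ ≤ M * (1 / 2 + ke z) := by nlinarith [ke_nonneg z]
    have hoff : ∀ z, z ∉ B' → ‖F z - c‖ ≤ ε / 2 := fun z hz => by
      rw [Real.norm_eq_abs]; exact (HB z (hoffB z hz) x).2.2.le
    have key := contactB_norm_integral_sub_le_of_dom μ S B' F H c (ε / 2) K L δ'' (measurableSet_toMeasurable μ B)
      hFm hHm hFH hHK hK0 hLpos (half_pos hε).le hδ hS hoff
    rw [Real.norm_eq_abs, Real.norm_eq_abs] at key
    rw [contactB_kinBar_zero]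
    exact key.trans (hfin (abs_nonneg _) hcR)

end Summit.AtomisticToContinuum.HydrodynamicLimit.Theorems.LocalSecondLawContact

end
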